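import Summits.NavierStokesRegularity.FluidComputer.ClayBlowupSingularPoint
import Literature.Analysis.FluidPDE.NSSuitableESSProofs
import HarnessLib

/-!
# CKN CONCENTRATION AT THE SINGULAR POINTS OF A CLAY BLOW-UP: the scale-invariant functional
# `r⁻² ∫∫_{Q_r(T,x₀)} (|u|³ + |p_N|^{3/2})` stays above `ε₀³` at EVERY small scale

Cell `ns-blowup`, seat `ns-blowup-ecbridge-2` (g6; the E–C endpoint theory seat). LABEL: E–C typing
(KERNEL — no named fact). WHAT THIS IS NOT: not Navier–Stokes evidence — a necessary condition on the
TYPE `ClayBlowup ν` (no inhabitant is claimed anywhere): what every breakdown scenario for Fefferman's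
(C) must exhibit near its singular points. Companion memo:
`run/shared/lean/pub/ns-blowup/ecbridge2/ECBRIDGE-2-MEMO-5.md`.

## Content

`ClayBlowupFarField.lean` applied Lemarié-Rieusset's ε-regularity criterion WITH FORCE (Thm. 14.4, the
tree theorem `lemarieRieusset_epsilon_regularity_holds`) on cylinders with tops strictly below the
lifespan. Here it is applied on backward cylinders `Q_r(T, x₀) = (T - r², T) × B(x₀, r)` whose TOP IS
THE LIFESPAN: the standing hypotheses on such a cylinder (`exists_isLRSuitableWeakSolutionOn_cylinder_top`)
are the THROUGH-`T` classes of `ClayBlowupSlabIntegrability.lean` (ONE energy bound, integrable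
dissipation, `p̃[u] ∈ L^{3/2}`, `Δ⁻¹∇·f ∈ L²`) together with the forced suitable weak solution `(u, p_N)`
of `ClayBlowupNormalisedPressure.lean`.

* `ClayBlowup.isBackwardBoundedAt_of_ckn_small` — **ε-regularity at the top**: there are `ε > 0`
  (Lemarié-Rieusset's `ε₀(ν, 3)`) and `r₁ > 0` such that, for every `x₀` and every `0 < r ≤ r₁`,
  `∫∫_{Q_r(T,x₀)} (|u|³ + |p_N|^{3/2}) ≤ ε³ r²` implies that `u` is backward bounded at `(T, x₀)`
  (the force condition `∫∫_{Q_r} |f|³ ≤ ε⁶ r⁻⁴` of Thm. 14.4 is automatic for small `r`, the Clay force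
  being bounded; the essential bound on `Q_{r/2}` is a pointwise one by continuity below `T`).
* **`ClayBlowup.ckn_concentration`** — hence at every SINGULAR point `x₀` of the final slice
  (`¬ IsBackwardBoundedAt u T x₀`; such points exist and fill a nonempty compact set,
  `ClayBlowupSingularPoint.lean`): `∫∫_{Q_r(T,x₀)} (|u|³ + |p_N|^{3/2}) > ε³ r²` for ALL `0 < r ≤ r₁`
  (Caffarelli–Kohn–Nirenberg 1982, Prop. 1 / Cor. 1 read contrapositively: the scale-invariant
  functional does not decay at a singular point).

References: P. G. Lemarié-Rieusset (2016), Thm. 14.4 (p. 505) [cite: LemarieRieusset2016, Thm. 14.4];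
L. Caffarelli, R. Kohn, L. Nirenberg, CPAM 35 (1982), Prop. 1, Cor. 1, §6 [cite: CaffarelliKohnNirenberg1982, Prop. 1];
C. L. Fefferman, Clay problem description, (C) [cite: FeffermanClay2006, (C)].
-/

noncomputable section

namespace Summit.NavierStokesRegularity.FluidComputer

open Set MeasureTheory Filter Topology Function TopologicalSpace Metric
open scoped ENNReal ContDiff NNReal
open Literature.Analysis.FluidPDE
open Summit.NavierStokesRegularity.NavierStokesRegularity
open Summit.NavierStokesRegularity.FluidComputer.PalasekTowerClayBridge
open Summit.NavierStokesRegularity.FluidComputer.ClayForcedLerayHopf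

namespace ClayBlowup

variable {ν : ℝ} (X : ClayBlowup ν)

/-! ## §1 The CKN majorant is integrable over the slab -/

/-- **The Caffarelli–Kohn–Nirenberg majorant `|u|³ + 2|p̃[u]|^{3/2} + 2δ^{-1/2}|Δ⁻¹∇·f|²` is integrable
over the lifespan slab** `(0, T) × ℝ³` of a Clay blow-up at `ν > 0`, for every `δ ≠ 0` (slice-wise
additivity, then `ClayBlowupSlabIntegrability.lean`). No named fact. [cite: Tao2011, Lemma 8.1] -/
theorem lintegral_slab_majorant_lt_top (hν : 0 < ν) {δ : ℝ≥0∞} (hδ0 : δ ≠ 0) :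
    ∫⁻ z in Ioo 0 X.T ×ˢ (univ : Set (EuclideanSpace ℝ (Fin 3))),
      (‖X.u z.1 z.2‖ₑ ^ (3 : ℕ) + 2 * ‖normalisedPressure (X.u z.1) z.2‖ₑ ^ (3 / 2 : ℝ) +
        2 * δ⁻¹ ^ (1 / 2 : ℝ) * ‖forcePotential (X.f z.1) z.2‖ₑ ^ 2) < ⊤ := by
  obtain ⟨c, hct, hslice⟩ := X.exists_lintegral_cube_slice_le hν
  obtain ⟨A, hAt, hA⟩ := X.energy_le hν
  obtain ⟨Pf, hPft, hPf⟩ := clayForce_forcePotential_bounds X.force_smooth X.force_decay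
  have hdis := X.lintegral_dissipation_lt_top hν
  set C₀ : ℝ≥0∞ := (steinConstThreeHalves : ℝ≥0∞) ^ (3 / 2 : ℝ) with hC₀
  have hC₀t : C₀ ≠ ⊤ := ENNReal.rpow_ne_top_of_nonneg (by norm_num) ENNReal.coe_ne_top
  set c' : ℝ≥0∞ := c + 2 * C₀ * c with hc'
  have hc't : c' ≠ ⊤ := ENNReal.add_ne_top.2 ⟨hct,
    ENNReal.mul_ne_top (ENNReal.mul_ne_top (by norm_num) hC₀t) hct⟩
  set P' : ℝ≥0∞ := 2 * δ⁻¹ ^ (1 / 2 : ℝ) * Pf with hP'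
  have hδ' : δ⁻¹ ^ (1 / 2 : ℝ) ≠ ⊤ :=
    ENNReal.rpow_ne_top_of_nonneg (by norm_num) (ENNReal.inv_ne_top.2 hδ0)
  have hP't : P' ≠ ⊤ := ENNReal.mul_ne_top (ENNReal.mul_ne_top (by norm_num) hδ') hPft.ne
  refine (SereginSverak2002.lintegral_slab_le_lintegral_lintegral _ _).trans_lt ?_
  have hae : ∀ᵐ t ∂(volume.restrict (Ioo 0 X.T)),
      (∫⁻ x, (‖X.u t x‖ₑ ^ (3 : ℕ) + 2 * ‖normalisedPressure (X.u t) x‖ₑ ^ (3 / 2 : ℝ) +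
        2 * δ⁻¹ ^ (1 / 2 : ℝ) * ‖forcePotential (X.f t) x‖ₑ ^ 2)) ≤
        c' * (1 + ∫⁻ x, ENNReal.ofReal (frobeniusNormSq (fderiv ℝ (X.u t) x))) + P' := by
    filter_upwards [ae_restrict_mem measurableSet_Ioo] with t htI
    have ht : t ∈ Ico 0 X.T := ⟨htI.1.le, htI.2⟩
    have hsm : ContDiff ℝ ∞ (X.u t) := X.classical.contDiff_velocity ht
    have hmem : MemLp (X.u t) 2 volume :=
      memLp_two_of_lintegral_enorm_sq_lt_top hsm.continuous.aestronglyMeasurable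
        ((hA t ht).trans_lt hAt)
    have hL2 : Integrable fun y => ‖X.u t y‖ ^ 2 := hmem.integrable_norm_pow two_ne_zero
    set D : ℝ≥0∞ := ∫⁻ x, ENNReal.ofReal (frobeniusNormSq (fderiv ℝ (X.u t) x)) with hD
    have hm1 : AEMeasurable (fun x => ‖X.u t x‖ₑ ^ (3 : ℕ)) volume :=
      hsm.continuous.aestronglyMeasurable.enorm.pow_const _
    have hm2 : AEMeasurable
        (fun x => 2 * ‖normalisedPressure (X.u t) x‖ₑ ^ (3 / 2 : ℝ)) volume :=
      ((X.aestronglyMeasurable_normalisedPressure_slice hν ht).enorm.pow_const _).const_mul _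
    have hm12 : AEMeasurable (fun x => ‖X.u t x‖ₑ ^ (3 : ℕ) +
        2 * ‖normalisedPressure (X.u t) x‖ₑ ^ (3 / 2 : ℝ)) volume := hm1.add hm2
    rw [lintegral_add_left' hm12, lintegral_add_left' hm1]
    have b1 : ∫⁻ x, ‖X.u t x‖ₑ ^ (3 : ℕ) ≤ c * (1 + D) := hslice t ht
    have b2 : ∫⁻ x, 2 * ‖normalisedPressure (X.u t) x‖ₑ ^ (3 / 2 : ℝ) ≤ 2 * C₀ * c * (1 + D) := by
      rw [lintegral_const_mul' _ _ (by norm_num)]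
      calc 2 * ∫⁻ x, ‖normalisedPressure (X.u t) x‖ₑ ^ (3 / 2 : ℝ)
          ≤ 2 * (C₀ * ∫⁻ x, ‖X.u t x‖ₑ ^ (3 : ℕ)) := by
            gcongr; exact SereginSverak2002.lintegral_normalisedPressure_rpow_le hsm hL2
        _ ≤ 2 * (C₀ * (c * (1 + D))) := by gcongr
        _ = 2 * C₀ * c * (1 + D) := by ring
    have b3 : ∫⁻ x, 2 * δ⁻¹ ^ (1 / 2 : ℝ) * ‖forcePotential (X.f t) x‖ₑ ^ 2 ≤ P' := by
      rw [lintegral_const_mul' _ _ (ENNReal.mul_ne_top (by norm_num) hδ'), hP']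
      gcongr
      exact (hPf t ht.1).2
    calc (∫⁻ x, ‖X.u t x‖ₑ ^ (3 : ℕ)) +
          (∫⁻ x, 2 * ‖normalisedPressure (X.u t) x‖ₑ ^ (3 / 2 : ℝ)) +
            ∫⁻ x, 2 * δ⁻¹ ^ (1 / 2 : ℝ) * ‖forcePotential (X.f t) x‖ₑ ^ 2
        ≤ c * (1 + D) + 2 * C₀ * c * (1 + D) + P' := add_le_add (add_le_add b1 b2) b3
      _ = c' * (1 + D) + P' := by rw [hc']; ring
  calc ∫⁻ t in Ioo 0 X.T, ∫⁻ x, (‖X.u t x‖ₑ ^ (3 : ℕ) +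
          2 * ‖normalisedPressure (X.u t) x‖ₑ ^ (3 / 2 : ℝ) +
            2 * δ⁻¹ ^ (1 / 2 : ℝ) * ‖forcePotential (X.f t) x‖ₑ ^ 2)
      ≤ ∫⁻ t in Ioo 0 X.T,
          (c' * (1 + ∫⁻ x, ENNReal.ofReal (frobeniusNormSq (fderiv ℝ (X.u t) x))) + P') :=
        lintegral_mono_ae hae
    _ = c' * (volume (Ioo 0 X.T) +
          ∫⁻ t in Ioo 0 X.T, ∫⁻ x, ENNReal.ofReal (frobeniusNormSq (fderiv ℝ (X.u t) x))) +
          P' * volume (Ioo 0 X.T) := by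
        rw [lintegral_add_right _ measurable_const, lintegral_const_mul' _ _ hc't,
          lintegral_add_left measurable_const, setLIntegral_const, setLIntegral_const, one_mul]
    _ < ⊤ := by
        have hvol : volume (Ioo 0 X.T) < ⊤ := by rw [Real.volume_Ioo]; exact ENNReal.ofReal_lt_top
        exact ENNReal.add_lt_top.2 ⟨ENNReal.mul_lt_top hc't.lt_top
          (ENNReal.add_lt_top.2 ⟨hvol, hdis⟩), ENNReal.mul_lt_top hP't.lt_top hvol⟩

/-! ## §2 The standing hypotheses of Thm. 14.4 on a backward cylinder whose top is the lifespan -/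

/-- The classical derivative is a weak spatial gradient of a Clay blow-up on its open lifespan slab.
[cite: CaffarelliKohnNirenberg1982, §2 (2.1)] -/
theorem hasWeakSpatialGradientOn_slab :
    HasWeakSpatialGradientOn (slab (EuclideanSpace ℝ (Fin 3)) (Ioo 0 X.T) isOpen_Ioo) X.u
      fun t x => fderiv ℝ (X.u t) x :=
  hasWeakSpatialGradientOn_of_contDiffOn isOpen_Ioo (coe_slab _ _).subset
    ((X.classical.mono Ioo_subset_Ico_self isOpen_Ioo.uniqueDiffOn).smooth_velocity.of_le
      (by norm_cast))

/-- **Lemarié-Rieusset's standing hypotheses (§14.3) on a backward cylinder `Q_r(T, x₀)` WHOSE TOP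
IS THE LIFESPAN**, `0 < r`, `r² ≤ T`, for `(u, p_N)` with force `f` and force exponent `3`: the global
classes on the cylinder are the through-`T` classes of a Clay blow-up (`energy_le`,
`lintegral_dissipation_lt_top`, the slab majorant), the force is bounded there, and the equations,
the weak gradient and the local energy inequality restrict from the open slab
(`isSuitableWeakSolutionOn_normalisedPressure`). No named fact.
[cite: LemarieRieusset2016, §14.3 hypotheses of Thm. 14.4 (p. 505)] -/
theorem exists_isLRSuitableWeakSolutionOn_cylinder_top (hν : 0 < ν)
    (x₀ : EuclideanSpace ℝ (Fin 3)) {r : ℝ} (hr : 0 < r) (hrT : r ^ 2 ≤ X.T) :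
    ∃ G : ℝ → EuclideanSpace ℝ (Fin 3) → EuclideanSpace ℝ (Fin 3) →L[ℝ] EuclideanSpace ℝ (Fin 3),
      IsLRSuitableWeakSolutionOn (parabolicCylinderOpens r ((X.T : ℝ), x₀)) ν 3 X.f X.u
        (fun t x => normalisedPressure (X.u t) x + forcePotential (X.f t) x) G := by
  have hT := X.T_pos
  have hsw := X.isSuitableWeakSolutionOn_normalisedPressure hν
  obtain ⟨G, hG, -, hloc⟩ := hsw.localEnergy
  set Ω : Opens (ℝ × EuclideanSpace ℝ (Fin 3)) := parabolicCylinderOpens r ((X.T : ℝ), x₀) with hΩdef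
  have hΩ : (Ω : Set (ℝ × EuclideanSpace ℝ (Fin 3))) = parabolicCylinder r ((X.T : ℝ), x₀) := rfl
  have hΩle : Ω ≤ slab (EuclideanSpace ℝ (Fin 3)) (Ioo 0 X.T) isOpen_Ioo := by
    intro z hz
    have hz' : z ∈ parabolicCylinder r ((X.T : ℝ), x₀) := hz
    rw [mem_parabolicCylinder] at hz'
    exact mem_slab.2 ⟨by nlinarith [hz'.1.1], hz'.1.2⟩
  have hsub' : (Ω : Set (ℝ × EuclideanSpace ℝ (Fin 3))) ⊆
      ((slab (EuclideanSpace ℝ (Fin 3)) (Ioo 0 X.T) isOpen_Ioo : Opens (ℝ × EuclideanSpace ℝ (Fin 3))) :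
        Set (ℝ × EuclideanSpace ℝ (Fin 3))) := fun z hz => hΩle hz
  have hΩsub : (Ω : Set (ℝ × EuclideanSpace ℝ (Fin 3))) ⊆
      Ioo 0 X.T ×ˢ (univ : Set (EuclideanSpace ℝ (Fin 3))) := fun z hz =>
    ⟨mem_slab.1 (hΩle hz), mem_univ _⟩
  have hvolΩ : volume (Ω : Set (ℝ × EuclideanSpace ℝ (Fin 3))) < ⊤ := by
    rw [hΩ, parabolicCylinder, Measure.volume_eq_prod, Measure.prod_prod, Real.volume_Ioo]
    exact ENNReal.mul_lt_top ENNReal.ofReal_lt_top measure_ball_lt_top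
  -- the energy class: ONE bound on `[0, T)`
  obtain ⟨E, hEt, hE⟩ := X.energy_le hν
  -- the dissipation through `T` and the a.e. identification of the weak gradients
  have hdis := X.lintegral_dissipation_lt_top hν
  have hae := hG.ae_eq X.hasWeakSpatialGradientOn_slab
  -- the force bound
  obtain ⟨M, N, -, hMN⟩ := clayForce_slice_sup_L1 X.force_smooth X.force_decay
  refine ⟨G,
    { isConnected := ?_
      energyClass := ?_
      weakGradient := hG.mono hΩle
      gradient_lt_top := ?_
      pressure_lt_top := ?_
      force_memLp := ?_
      distributional := (hsw.of_le hΩle).distributional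
      localEnergy := fun φ hφ hφ0 => hloc φ (hφ.mono hΩle) hφ0 }⟩
  · -- a cylinder is connected
    rw [hΩ, parabolicCylinder]
    refine ⟨⟨(X.T - r ^ 2 / 2, x₀), ?_⟩, ((convex_Ioo _ _).prod (convex_ball _ _)).isPreconnected⟩
    exact ⟨⟨by nlinarith, by nlinarith⟩, mem_ball_self hr⟩
  · -- `u ∈ L^∞_t L²_x(Ω)`
    refine ⟨E.toNNReal, ae_of_all _ fun t => ?_⟩
    rw [ENNReal.coe_toNNReal hEt.ne]
    by_cases ht : t ∈ Ico 0 X.T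
    · exact (lintegral_mono fun x => indicator_le_self _ _ _).trans (hE t ht)
    · have h0 : ∀ x, (Ω : Set (ℝ × EuclideanSpace ℝ (Fin 3))).indicator
          (fun z : ℝ × EuclideanSpace ℝ (Fin 3) => ‖X.u z.1 z.2‖ₑ ^ 2) (t, x) = 0 := by
        intro x
        rw [indicator_of_notMem]
        intro hz
        exact ht ⟨(mem_slab.1 (hΩle hz)).1.le, (mem_slab.1 (hΩle hz)).2⟩
      simp only [h0, lintegral_zero, zero_le]
  · -- `∇u ∈ L²(Ω)` through `T`
    have e : ∫⁻ w in (Ω : Set (ℝ × EuclideanSpace ℝ (Fin 3))),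
        ENNReal.ofReal (frobeniusNormSq (G w.1 w.2)) =
          ∫⁻ w in (Ω : Set (ℝ × EuclideanSpace ℝ (Fin 3))),
            ENNReal.ofReal (frobeniusNormSq (fderiv ℝ (X.u w.1) w.2)) := by
      refine lintegral_congr_ae ?_
      have hae' := ae_restrict_of_ae_restrict_of_subset hsub' hae
      filter_upwards [hae'] with w hw
      change ENNReal.ofReal (frobeniusNormSq (uncurry G w)) =
        ENNReal.ofReal (frobeniusNormSq (uncurry (fun t x => fderiv ℝ (X.u t) x) w))
      rw [hw]
    rw [e]
    refine ((lintegral_mono_set hΩsub).trans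
      (SereginSverak2002.lintegral_slab_le_lintegral_lintegral _ _)).trans_lt hdis
  · -- `p_N ∈ L^{3/2}(Ω)` through `T`
    have hmaj := X.lintegral_slab_majorant_lt_top hν one_ne_zero
    have hpt : ∀ z : ℝ × EuclideanSpace ℝ (Fin 3),
        ‖normalisedPressure (X.u z.1) z.2 + forcePotential (X.f z.1) z.2‖ₑ ^ (3 / 2 : ℝ) ≤
          (‖X.u z.1 z.2‖ₑ ^ (3 : ℕ) + 2 * ‖normalisedPressure (X.u z.1) z.2‖ₑ ^ (3 / 2 : ℝ) +
            2 * (1 : ℝ≥0∞)⁻¹ ^ (1 / 2 : ℝ) * ‖forcePotential (X.f z.1) z.2‖ₑ ^ 2) +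
            2 * (1 : ℝ≥0∞) ^ (3 / 2 : ℝ) := by
      intro z
      have h1 := enorm_add_rpow_threeHalves_le (normalisedPressure (X.u z.1) z.2)
        (forcePotential (X.f z.1) z.2)
      have h2 := rpow_threeHalves_le_add ‖forcePotential (X.f z.1) z.2‖ₑ ENNReal.one_ne_top
      calc ‖normalisedPressure (X.u z.1) z.2 + forcePotential (X.f z.1) z.2‖ₑ ^ (3 / 2 : ℝ)
          ≤ 2 * (‖normalisedPressure (X.u z.1) z.2‖ₑ ^ (3 / 2 : ℝ) +
              ((1 : ℝ≥0∞) ^ (3 / 2 : ℝ) +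
                (1 : ℝ≥0∞)⁻¹ ^ (1 / 2 : ℝ) * ‖forcePotential (X.f z.1) z.2‖ₑ ^ 2)) :=
            h1.trans (by gcongr)
        _ = (2 * ‖normalisedPressure (X.u z.1) z.2‖ₑ ^ (3 / 2 : ℝ) +
              2 * (1 : ℝ≥0∞)⁻¹ ^ (1 / 2 : ℝ) * ‖forcePotential (X.f z.1) z.2‖ₑ ^ 2) +
              2 * (1 : ℝ≥0∞) ^ (3 / 2 : ℝ) := by ring
        _ ≤ _ := add_le_add (add_le_add (self_le_add_left _ _) le_rfl) le_rfl
    refine lt_of_le_of_lt (lintegral_mono fun z => hpt z) ?_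
    rw [lintegral_add_right _ measurable_const, setLIntegral_const]
    refine ENNReal.add_lt_top.2 ⟨((lintegral_mono_set hΩsub).trans_lt hmaj), ?_⟩
    exact ENNReal.mul_lt_top (ENNReal.mul_lt_top (by norm_num)
      (ENNReal.rpow_lt_top_of_nonneg (by norm_num) ENNReal.one_ne_top)) hvolΩ
  · -- `f ∈ L³(Ω)`: continuous and bounded on `[0, ∞) × ℝ³ ⊇ Ω`
    haveI : IsFiniteMeasure (volume.restrict (Ω : Set (ℝ × EuclideanSpace ℝ (Fin 3)))) :=
      ⟨by rw [Measure.restrict_apply_univ]; exact hvolΩ⟩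
    have hKsub : (Ω : Set (ℝ × EuclideanSpace ℝ (Fin 3))) ⊆
        Ici (0 : ℝ) ×ˢ (univ : Set (EuclideanSpace ℝ (Fin 3))) := fun z hz =>
      ⟨(le_of_lt (hΩsub hz).1.1 : (0 : ℝ) ≤ z.1), mem_univ _⟩
    have hmeas : AEStronglyMeasurable (uncurry X.f)
        (volume.restrict (Ω : Set (ℝ × EuclideanSpace ℝ (Fin 3)))) :=
      (X.force_smooth.continuousOn.mono hKsub).aestronglyMeasurable Ω.isOpen.measurableSet
    have hbd : ∀ᵐ z ∂(volume.restrict (Ω : Set (ℝ × EuclideanSpace ℝ (Fin 3)))),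
        ‖uncurry X.f z‖ ≤ M := by
      rw [ae_restrict_iff' Ω.isOpen.measurableSet]
      exact Eventually.of_forall fun z hz => (hMN z.1 (hKsub hz).1).1 z.2
    exact (memLp_top_of_bound hmeas M hbd).mono_exponent le_top

/-! ## §3 ε-regularity at the top of the lifespan, and CKN concentration at the singular points -/

/-- The force condition of Thm. 14.4 (`q = 3`) at small scales, for a bounded force: if `|f| ≤ M`,
`0 < r ≤ 1` and `r ≤ ε⁶ / (M³ V₁ + 1)` then `M³ · (r² · (r³ V₁)) ≤ ε^{2·3} r^{5-3·3}`. [folklore] -/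
theorem force_threshold {ε M V₁ r : ℝ} (hM : 0 ≤ M) (hV : 0 ≤ V₁) (hr : 0 < r)
    (hr1 : r ≤ 1) (hrε : r ≤ ε ^ 6 / (M ^ 3 * V₁ + 1)) :
    M ^ 3 * (r ^ 2 * (r ^ 3 * V₁)) ≤ ε ^ (2 * (3 : ℝ)) * r ^ (5 - 3 * (3 : ℝ)) := by
  have e1 : ε ^ (2 * (3 : ℝ)) = ε ^ 6 := by
    rw [show (2 * (3 : ℝ)) = ((6 : ℕ) : ℝ) by norm_num, Real.rpow_natCast]
  have e2 : r ^ (5 - 3 * (3 : ℝ)) = (r ^ 4)⁻¹ := by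
    rw [show (5 - 3 * (3 : ℝ)) = -(((4 : ℕ) : ℝ)) by norm_num, Real.rpow_neg hr.le,
      Real.rpow_natCast]
  rw [e1, e2, le_mul_inv_iff₀ (pow_pos hr 4)]
  have hden : 0 < M ^ 3 * V₁ + 1 := by positivity
  have h1 : r * (M ^ 3 * V₁ + 1) ≤ ε ^ 6 := (le_div_iff₀ hden).1 hrε
  have h9 : r ^ 9 ≤ r := by
    calc r ^ 9 ≤ r ^ 1 := pow_le_pow_of_le_one hr.le hr1 (by norm_num)
      _ = r := pow_one r
  calc M ^ 3 * (r ^ 2 * (r ^ 3 * V₁)) * r ^ 4 = M ^ 3 * V₁ * r ^ 9 := by ring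
    _ ≤ M ^ 3 * V₁ * r := by gcongr
    _ ≤ (M ^ 3 * V₁ + 1) * r := by gcongr; linarith
    _ = r * (M ^ 3 * V₁ + 1) := by ring
    _ ≤ ε ^ 6 := h1

/-- **ε-REGULARITY AT THE TOP OF THE LIFESPAN.** For a Clay blow-up at `ν > 0` there are `ε > 0`
(Lemarié-Rieusset's `ε₀(ν, 3)`) and `r₁ > 0` such that for every `x₀` and every `0 < r ≤ r₁`:
if `∫∫_{Q_r(T,x₀)} (|u|³ + |p_N|^{3/2}) ≤ ε³ r²` (`p_N = p̃[u] + Δ⁻¹∇·f`, `Q_r(T,x₀) = (T-r², T) × B(x₀,r)`),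
then `u` is backward bounded at `(T, x₀)` — bounded on `Q_{r/2}(T, x₀)`. Thm. 14.4 with force on the
top cylinder (`exists_isLRSuitableWeakSolutionOn_cylinder_top`); its force condition holds for
`r ≤ r₁` because the Clay force is bounded (`force_threshold`); the essential bound is pointwise by
continuity below `T`. No named fact. [cite: LemarieRieusset2016, Thm. 14.4 (p. 505)]
[cite: CaffarelliKohnNirenberg1982, Prop. 1] -/
theorem isBackwardBoundedAt_of_ckn_small (hν : 0 < ν) :
    ∃ ε r₁ : ℝ, 0 < ε ∧ 0 < r₁ ∧ ∀ (x₀ : EuclideanSpace ℝ (Fin 3)) (r : ℝ), 0 < r → r ≤ r₁ →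
      ∫⁻ z in parabolicCylinder r ((X.T : ℝ), x₀),
          (‖X.u z.1 z.2‖ₑ ^ (3 : ℕ) +
            ‖normalisedPressure (X.u z.1) z.2 + forcePotential (X.f z.1) z.2‖ₑ ^ (3 / 2 : ℝ)) ≤
        ENNReal.ofReal (ε ^ 3 * r ^ 2) →
      IsBackwardBoundedAt X.u X.T x₀ := by
  have hT := X.T_pos
  obtain ⟨ε₀, C₀, hε₀, -, H⟩ :=
    (lemarieRieusset_epsilon_regularity_iff.1 lemarieRieusset_epsilon_regularity_holds) ν 3 hν
      (by norm_num)
  obtain ⟨M, N, -, hMN⟩ := clayForce_slice_sup_L1 X.force_smooth X.force_decay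
  have hM0 : 0 ≤ M := (norm_nonneg _).trans ((hMN 0 le_rfl).1 0)
  -- the unit-ball volume
  set V₁e : ℝ≥0∞ := volume (ball (0 : EuclideanSpace ℝ (Fin 3)) 1) with hV₁e
  have hV₁top : V₁e ≠ ⊤ := measure_ball_lt_top.ne
  set V₁ : ℝ := V₁e.toReal with hV₁
  have hV₁0 : 0 ≤ V₁ := ENNReal.toReal_nonneg
  have hV₁eq : V₁e = ENNReal.ofReal V₁ := (ENNReal.ofReal_toReal hV₁top).symm
  -- the radius threshold
  set r₁ : ℝ := min (min 1 (Real.sqrt (X.T / 2))) (ε₀ ^ 6 / (M ^ 3 * V₁ + 1)) with hr₁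
  have hr₁pos : 0 < r₁ :=
    lt_min (lt_min one_pos (Real.sqrt_pos.2 (by positivity))) (div_pos (pow_pos hε₀ 6) (by positivity))
  refine ⟨ε₀, r₁, hε₀, hr₁pos, fun x₀ r hr hrr₁ hsmall => ?_⟩
  have hr1 : r ≤ 1 := hrr₁.trans ((min_le_left _ _).trans (min_le_left _ _))
  have hrε : r ≤ ε₀ ^ 6 / (M ^ 3 * V₁ + 1) := hrr₁.trans (min_le_right _ _)
  have hrsq : r ^ 2 ≤ X.T / 2 := by
    have h := hrr₁.trans ((min_le_left _ _).trans (min_le_right _ _))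
    calc r ^ 2 ≤ Real.sqrt (X.T / 2) ^ 2 := pow_le_pow_left₀ hr.le h 2
      _ = X.T / 2 := Real.sq_sqrt (by positivity)
  obtain ⟨G, hLR⟩ := X.exists_isLRSuitableWeakSolutionOn_cylinder_top hν x₀ hr (by linarith)
  -- the force condition at scale `r`
  have hforce : ∫⁻ w in parabolicCylinder r ((X.T : ℝ), x₀), ‖X.f w.1 w.2‖ₑ ^ (3 : ℝ) ≤
      ENNReal.ofReal (ε₀ ^ (2 * (3 : ℝ)) * r ^ (5 - 3 * (3 : ℝ))) := by
    have hpt : ∀ w ∈ parabolicCylinder r ((X.T : ℝ), x₀),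
        ‖X.f w.1 w.2‖ₑ ^ (3 : ℝ) ≤ ENNReal.ofReal (M ^ 3) := by
      intro w hw
      rw [mem_parabolicCylinder] at hw
      have hw0 : 0 ≤ w.1 := by nlinarith [hw.1.1]
      rw [show (3 : ℝ) = ((3 : ℕ) : ℝ) by norm_num, ENNReal.rpow_natCast, ← ofReal_norm,
        ← ENNReal.ofReal_pow (norm_nonneg _)]
      exact ENNReal.ofReal_le_ofReal (pow_le_pow_left₀ (norm_nonneg _) ((hMN w.1 hw0).1 w.2) 3)
    have hvol : volume (parabolicCylinder r ((X.T : ℝ), x₀)) =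
        ENNReal.ofReal (r ^ 2) * (ENNReal.ofReal (r ^ 3) * V₁e) := by
      rw [parabolicCylinder, Measure.volume_eq_prod, Measure.prod_prod, Real.volume_Ioo,
        Measure.addHaar_ball_of_pos _ _ hr, finrank_euclideanSpace_fin]
      congr 2
      ring
    calc ∫⁻ w in parabolicCylinder r ((X.T : ℝ), x₀), ‖X.f w.1 w.2‖ₑ ^ (3 : ℝ)
        ≤ ∫⁻ _ in parabolicCylinder r ((X.T : ℝ), x₀), ENNReal.ofReal (M ^ 3) :=
          setLIntegral_mono' (isOpen_parabolicCylinder _ _).measurableSet hpt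
      _ = ENNReal.ofReal (M ^ 3) * (ENNReal.ofReal (r ^ 2) * (ENNReal.ofReal (r ^ 3) * V₁e)) := by
          rw [setLIntegral_const, hvol]
      _ = ENNReal.ofReal (M ^ 3 * (r ^ 2 * (r ^ 3 * V₁))) := by
          rw [hV₁eq, ← ENNReal.ofReal_mul (by positivity), ← ENNReal.ofReal_mul (by positivity),
            ← ENNReal.ofReal_mul (by positivity)]
      _ ≤ ENNReal.ofReal (ε₀ ^ (2 * (3 : ℝ)) * r ^ (5 - 3 * (3 : ℝ))) :=
          ENNReal.ofReal_le_ofReal (force_threshold hM0 hV₁0 hr hr1 hrε)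
  -- Thm. 14.4 on the top cylinder
  have hbound := H (parabolicCylinderOpens r ((X.T : ℝ), x₀)) X.f X.u _ G hLR ((X.T : ℝ), x₀) r ε₀ hr
    Subset.rfl hε₀.le le_rfl hsmall hforce
  -- from the essential bound to a pointwise one, by continuity below `T`
  have hcont : ContinuousOn (uncurry X.u) (parabolicCylinder (r / 2) ((X.T : ℝ), x₀)) := by
    refine X.classical.smooth_velocity.continuousOn.mono fun w hw => ?_
    rw [mem_parabolicCylinder] at hw
    exact ⟨⟨by nlinarith [hw.1.1], hw.1.2⟩, mem_univ _⟩
  have hall := SereginSverak2002.norm_le_of_ae_restrict_of_continuousOn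
    (isOpen_parabolicCylinder _ _) hcont hbound
  refine ⟨r / 2, by positivity, C₀ * ε₀ / r, fun t ht x hx => hall (t, x) ?_⟩
  rw [mem_parabolicCylinder]
  exact ⟨ht, mem_ball.1 hx⟩

/-- **CKN CONCENTRATION AT THE SINGULAR POINTS OF A CLAY BLOW-UP.** For a Clay blow-up at `ν > 0`
there are `ε > 0` and `r₁ > 0` such that at every singular point `x₀` of the final slice
(`¬ IsBackwardBoundedAt u T x₀` — such points exist, `exists_singularPoint`) and EVERY scale
`0 < r ≤ r₁`: `∫∫_{Q_r(T,x₀)} (|u|³ + |p_N|^{3/2}) > ε³ r²`. The scale-invariant Caffarelli–Kohn–Nirenberg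
functional does not decay at a singularity (CKN 1982, Prop. 1 / Cor. 1, contrapositive; with force).
No named fact. [cite: CaffarelliKohnNirenberg1982, Prop. 1] [cite: LemarieRieusset2016, Thm. 14.4 (p. 505)] -/
theorem ckn_concentration (hν : 0 < ν) :
    ∃ ε r₁ : ℝ, 0 < ε ∧ 0 < r₁ ∧ ∀ x₀ : EuclideanSpace ℝ (Fin 3), ¬ IsBackwardBoundedAt X.u X.T x₀ →
      ∀ r : ℝ, 0 < r → r ≤ r₁ →
        ENNReal.ofReal (ε ^ 3 * r ^ 2) <
          ∫⁻ z in parabolicCylinder r ((X.T : ℝ), x₀),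
            (‖X.u z.1 z.2‖ₑ ^ (3 : ℕ) +
              ‖normalisedPressure (X.u z.1) z.2 + forcePotential (X.f z.1) z.2‖ₑ ^ (3 / 2 : ℝ)) := by
  obtain ⟨ε, r₁, hε, hr₁, h⟩ := X.isBackwardBoundedAt_of_ckn_small hν
  exact ⟨ε, r₁, hε, hr₁, fun x₀ hx₀ r hr hrr₁ => not_le.1 fun hle => hx₀ (h x₀ r hr hrr₁ hle)⟩

/-- **Some point of the final slice carries the concentration**: there are `ε, r₁ > 0` and `x₀` with
`∫∫_{Q_r(T,x₀)} (|u|³ + |p_N|^{3/2}) > ε³ r²` for all `0 < r ≤ r₁` (`exists_not_isBackwardBoundedAt` +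
`ckn_concentration`). No named fact. [cite: CaffarelliKohnNirenberg1982, Prop. 1] -/
theorem exists_point_ckn_concentration (hν : 0 < ν) :
    ∃ ε r₁ : ℝ, 0 < ε ∧ 0 < r₁ ∧ ∃ x₀ : EuclideanSpace ℝ (Fin 3), ∀ r : ℝ, 0 < r → r ≤ r₁ →
      ENNReal.ofReal (ε ^ 3 * r ^ 2) <
        ∫⁻ z in parabolicCylinder r ((X.T : ℝ), x₀),
          (‖X.u z.1 z.2‖ₑ ^ (3 : ℕ) +
            ‖normalisedPressure (X.u z.1) z.2 + forcePotential (X.f z.1) z.2‖ₑ ^ (3 / 2 : ℝ)) := by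
  obtain ⟨ε, r₁, hε, hr₁, h⟩ := X.ckn_concentration hν
  obtain ⟨x₀, hx₀⟩ := X.exists_not_isBackwardBoundedAt hν
  exact ⟨ε, r₁, hε, hr₁, x₀, h x₀ hx₀⟩

end ClayBlowup

end Summit.NavierStokesRegularity.FluidComputer

end
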